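import Literature.Analysis.FluidPDE.NewtonLocalPotential
import Literature.Analysis.FluidPDE.LocalBiotSavartCalculus
import Literature.Analysis.FluidPDE.BallCutoff
import HarnessLib

/-!
# The local Biot–Savart law: a pointwise bound for `∇u` on a ball by a localised singular
# integral of the vorticity plus an energy remainder

Analysis/FluidPDE support file for the proof of the nonlinear estimate `Y₆` of Tao 2011, §10,
proof of Thm. 10.1 (arXiv:1108.1165, p. 32): "The first step is to convert `∇u` into an
expression that only involves `ω` (modulo lower order terms), while staying inside the domain
`Ω`. To do this, we first observe from the divergence-free nature of `u` that `Δu = ∇ × ω` [up to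
sign]. Let `ψᵢ` be a smooth cutoff to the ball `3Bᵢ` that equals `1` on `2Bᵢ`. On `2Bᵢ`, we thus
have the local Biot-Savart law `u = O(Δ⁻¹∇(ψᵢω)) + v` where `v` is harmonic on `2Bᵢ` […] we thus
have the pointwise estimate `|∇u| ≲ |∇Δ⁻¹∇(ψᵢω)| + rᵢ^{-3/2}‖ω‖_{L²(2Bᵢ)} + rᵢ^{-5/2}‖u‖_{L²(2Bᵢ)}`
on `Bᵢ`", together with "From Plancherel's theorem we have
`‖∇Δ⁻¹∇(ψᵢω)‖_{L²} ≲ ‖ψᵢω‖_{L²} ≲ ‖ω‖_{L²(2Bᵢ)}`" and (for the balls in the transition layer) "we use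
Hölder to bound `r^{-3/2}‖u‖_{L²(2Bᵢ)} ≲ ‖u‖_{L^∞}`".

We prove this with `Δ⁻¹` realised at the scale `r` of the ball by the truncated Newtonian
potential `N = N_{r/2,r}` of `NewtonLocalPotential` (Green's representation
`g = N[Δg] + Λ[g]`, `Λ` the smoothing operator of scale `r`), which replaces Tao's harmonic
remainder `v` and the mean-value principle by the explicit smooth convolution `Λ[ψu]`:
for `u ∈ C^∞(ℝ³; ℝ³)` divergence free, a centre `c` and a radius `r > 0`, with `ψ` a smooth
cutoff equal to `1` on `B̄(c, 2r)` and supported in `B(c, 3r)` (`ballCutoff`, `FluidPDE/BallCutoff`),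

* on `B(c, r)`: `uₘ = -(∂_{m+1}N[ψω_{m+2}] - ∂_{m+2}N[ψω_{m+1}]) + Λ[ψuₘ]` (`eqOn_coord_localRep`;
  `Δu = -curl ω`, `LocalBiotSavartCalculus.laplacian_eq_neg_curl_curl`), hence
  `|∂ₖuₘ(x)| ≤ Σ_{a,b} |∂ₖ∂ₐN[ψω_b](x)| + |∂ₖΛ[ψuₘ](x)|`;
* **`local_biotSavart_bound`**: there is a continuous `F ≥ 0` with
  `∫ F² ≤ 486(1 + M²) ∫_{B(c,3r)} |ω|²` (`M = regLaplacianMass`, the Hessian `L²` bound of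
  `NewtonLocalPotential`) such that for `x ∈ B(c, r)`
  `‖Du(x)‖ ≤ F(x) + 3C₂ r^{-5/2} ‖u‖_{L²(ℝ³)}` and, if `|u| ≤ s` everywhere,
  `‖Du(x)‖ ≤ F(x) + 3C₁ r⁻¹ s` (`C₁ = lamGradL1`, `C₂ = lamGradL2`, the gradient masses of the unit
  smoothing kernel, `LocalBiotSavartCalculus`).

## References

* T. Tao, arXiv:1108.1165 (`Tao2011`), §10, proof of Thm. 10.1 (p. 32, the local Biot–Savart law
  and the pointwise estimate for `∇u`).
* A. J. Majda, A. L. Bertozzi, *Vorticity and Incompressible Flow*, CUP 2002, §2.4.1 (Biot–Savart).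
* D. Gilbarg, N. S. Trudinger (2001), (2.16)–(2.17).
-/

noncomputable section

open MeasureTheory Set Filter Topology Function Metric InnerProductSpace
open scoped ENNReal NNReal RealInnerProductSpace ContDiff Laplacian

namespace Literature.Analysis.FluidPDE

/-- Local notation for physical space `ℝ³ = EuclideanSpace ℝ (Fin 3)`. -/
local notation "ℝ³" => EuclideanSpace ℝ (Fin 3)

/-- Local notation for the standard basis vectors. -/
local notation "𝐞" j => EuclideanSpace.single (j : Fin 3) (1 : ℝ)

/-! ### The components of the curl, uniformly in the index -/

section CurlCoord

/-- The index `m + 1 (mod 3)`. [folklore] -/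
def succIdx : Fin 3 → Fin 3 := ![1, 2, 0]

/-- The index `m + 2 (mod 3)`. [folklore] -/
def succIdx₂ : Fin 3 → Fin 3 := ![2, 0, 1]

/-- **Components of the curl**: `(curl v)ₘ = ∂_{m+1} v_{m+2} - ∂_{m+2} v_{m+1}`. [folklore] -/
theorem curl_coord {v : ℝ³ → ℝ³} {y : ℝ³} (hv : DifferentiableAt ℝ v y) (m : Fin 3) :
    curl v y m = fderiv ℝ (fun z => v z (succIdx₂ m)) y (𝐞 (succIdx m)) -
      fderiv ℝ (fun z => v z (succIdx m)) y (𝐞 (succIdx₂ m)) := by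
  fin_cases m
  · exact curl_coord_zero hv
  · exact curl_coord_one hv
  · exact curl_coord_two hv

end CurlCoord

/-! ### The localised fields and the local representation of `uₘ` -/

section Representation

variable {u : ℝ³ → ℝ³} {c : ℝ³} {r : ℝ}

/-- The localised vorticity component `W_b = ψ · ω_b`, `ω = curl u`. [folklore] -/
def locVort (u : ℝ³ → ℝ³) (c : ℝ³) (r : ℝ) (b : Fin 3) (y : ℝ³) : ℝ :=
  ballCutoff c r y * curl u y b

/-- The localised velocity component `Φₘ = ψ · uₘ`. [folklore] -/
def locVel (u : ℝ³ → ℝ³) (c : ℝ³) (r : ℝ) (m : Fin 3) (y : ℝ³) : ℝ :=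
  ballCutoff c r y * u y m

/-- `W_b` is smooth when `u` is. [folklore] -/
theorem contDiff_locVort (hu : ContDiff ℝ ∞ u) (c : ℝ³) (r : ℝ) (b : Fin 3) {n : ℕ} :
    ContDiff ℝ n (locVort u c r b) := by
  have hω : ContDiff ℝ n (curl u) :=
    contDiff_curl (n := n) (hu.of_le (by exact_mod_cast le_top))
  exact ((contDiff_ballCutoff c r (n := n))).mul (contDiff_apply_coord hω b)

/-- `Φₘ` is smooth when `u` is. [folklore] -/
theorem contDiff_locVel (hu : ContDiff ℝ ∞ u) (c : ℝ³) (r : ℝ) (m : Fin 3) {n : ℕ} :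
    ContDiff ℝ n (locVel u c r m) :=
  (contDiff_ballCutoff c r (n := n)).mul (contDiff_apply_coord (hu.of_le (by exact_mod_cast le_top)) m)

/-- `W_b` has compact support. [folklore] -/
theorem hasCompactSupport_locVort (hr : 0 < r) (u : ℝ³ → ℝ³) (b : Fin 3) :
    HasCompactSupport (locVort u c r b) :=
  (hasCompactSupport_ballCutoff hr).mul_right

/-- `Φₘ` has compact support. [folklore] -/
theorem hasCompactSupport_locVel (hr : 0 < r) (u : ℝ³ → ℝ³) (m : Fin 3) :
    HasCompactSupport (locVel u c r m) :=
  (hasCompactSupport_ballCutoff hr).mul_right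

/-- On `B(c, 2r)` the Laplacian of `Φₘ` is minus the `m`-th component of `curl ω`, expressed
through the localised vorticity: `ΔΦₘ(y) = -(∂_{m+1}W_{m+2}(y) - ∂_{m+2}W_{m+1}(y))`. [folklore] -/
theorem laplacian_locVel_eq (hu : ContDiff ℝ ∞ u) (hdiv : VectorCalculus.IsDivFree u) (hr : 0 < r)
    (m : Fin 3) {y : ℝ³} (hy : y ∈ ball c (2 * r)) :
    (Δ (locVel u c r m)) y =
      -(fderiv ℝ (locVort u c r (succIdx₂ m)) y (𝐞 (succIdx m)) -
        fderiv ℝ (locVort u c r (succIdx m)) y (𝐞 (succIdx₂ m))) := by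
  have hu2 : ContDiff ℝ 2 u := hu.of_le (by norm_cast)
  -- `ΔΦₘ = Δuₘ` near `y`
  have h1 : (Δ (locVel u c r m)) y = (Δ (fun z => u z m)) y :=
    (laplacian_congr_nhds (ballCutoff_mul_eventuallyEq hr (fun z => u z m) hy)).eq_of_nhds
  rw [h1, laplacian_coord_eq_neg_curl_curl hu2 hdiv y m]
  -- components of `curl (curl u)`
  have hω1 : ContDiff ℝ 1 (curl u) := contDiff_curl (n := 1) hu2
  rw [curl_coord (hω1.differentiable one_ne_zero y) m]
  -- localise the two partial derivatives
  have hloc : ∀ b : Fin 3, fderiv ℝ (fun z => curl u z b) y = fderiv ℝ (locVort u c r b) y :=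
    fun b => ((ballCutoff_mul_eventuallyEq hr (fun z => curl u z b) hy).fderiv_eq).symm
  rw [hloc, hloc]

/-- Green's representation for `Φₘ`: `Φₘ = N[ΔΦₘ] + Λ[Φₘ]` everywhere. [folklore] -/
theorem locVel_eq_rep (hu : ContDiff ℝ ∞ u) (hr : 0 < r) (m : Fin 3) (x : ℝ³) :
    locVel u c r m x = newtonNearPotential (r / 2) r (Δ (locVel u c r m)) x +
      newtonFarSmoothing (r / 2) r (locVel u c r m) x :=
  eq_newtonNearPotential_laplacian_add (half_pos hr) (half_lt_self hr) (contDiff_locVel hu c r m) x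

/-- The singular part on `B(c, r)`: `N[ΔΦₘ](x) = -(∂_{m+1}N[W_{m+2}](x) - ∂_{m+2}N[W_{m+1}](x))`
(the kernel has radius `r`, so only the values of `ΔΦₘ` on `B(c, 2r)` enter). [folklore] -/
theorem newtonNearPotential_laplacian_locVel_eq (hu : ContDiff ℝ ∞ u)
    (hdiv : VectorCalculus.IsDivFree u) (hr : 0 < r) (m : Fin 3) {x : ℝ³} (hx : x ∈ ball c r) :
    newtonNearPotential (r / 2) r (Δ (locVel u c r m)) x =
      -(fderiv ℝ (newtonNearPotential (r / 2) r (locVort u c r (succIdx₂ m))) x (𝐞 (succIdx m)) -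
        fderiv ℝ (newtonNearPotential (r / 2) r (locVort u c r (succIdx m))) x (𝐞 (succIdx₂ m))) := by
  have h₀ : (0 : ℝ) ≤ r / 2 := (half_pos hr).le
  have h₁ : r / 2 < r := half_lt_self hr
  set A : ℝ³ → ℝ := fun y => fderiv ℝ (locVort u c r (succIdx₂ m)) y (𝐞 (succIdx m)) with hA
  set B : ℝ³ → ℝ := fun y => fderiv ℝ (locVort u c r (succIdx m)) y (𝐞 (succIdx₂ m)) with hB
  have hW1 : ∀ b, ContDiff ℝ 1 (locVort u c r b) := fun b => contDiff_locVort hu c r b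
  have hAc : Continuous A := ((hW1 _).continuous_fderiv one_ne_zero).clm_apply continuous_const
  have hBc : Continuous B := ((hW1 _).continuous_fderiv one_ne_zero).clm_apply continuous_const
  -- pointwise identity of the integrands
  have hpt : ∀ z : ℝ³, newtonNear (r / 2) r z * (Δ (locVel u c r m)) (x - z) =
      newtonNear (r / 2) r z * (-(A (x - z) - B (x - z))) := by
    intro z
    rcases le_or_gt r ‖z‖ with hz | hz
    · rw [newtonNear_eq_zero h₀ h₁ hz, zero_mul, zero_mul]
    · have hy : x - z ∈ ball c (2 * r) := by
        rw [mem_ball, dist_eq_norm] at hx ⊢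
        calc ‖x - z - c‖ = ‖(x - c) - z‖ := by abel_nf
          _ ≤ ‖x - c‖ + ‖z‖ := norm_sub_le _ _
          _ < r + r := add_lt_add hx hz
          _ = 2 * r := by ring
      rw [laplacian_locVel_eq hu hdiv hr m hy]
  rw [newtonNearPotential_apply]
  simp_rw [hpt]
  have hiA : Integrable fun z => newtonNear (r / 2) r z * A (x - z) := by
    have := integrable_smul_comp_sub (integrable_newtonNear h₀ h₁) (newtonNear_eq_zero_of_lt h₀ h₁) hAc x
    simpa only [smul_eq_mul] using this
  have hiB : Integrable fun z => newtonNear (r / 2) r z * B (x - z) := by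
    have := integrable_smul_comp_sub (integrable_newtonNear h₀ h₁) (newtonNear_eq_zero_of_lt h₀ h₁) hBc x
    simpa only [smul_eq_mul] using this
  have hsplit : (fun z => newtonNear (r / 2) r z * (-(A (x - z) - B (x - z)))) =
      fun z => -(newtonNear (r / 2) r z * A (x - z) - newtonNear (r / 2) r z * B (x - z)) :=
    funext fun z => by ring
  rw [hsplit, integral_neg, integral_sub hiA hiB, ← newtonNearPotential_apply, ← newtonNearPotential_apply,
    ← fderiv_newtonNearPotential_apply h₀ h₁ (hW1 _), ← fderiv_newtonNearPotential_apply h₀ h₁ (hW1 _)]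

/-- The local representative of `uₘ`:
`Rₘ = -(∂_{m+1}N[W_{m+2}] - ∂_{m+2}N[W_{m+1}]) + Λ[Φₘ]`. [folklore] -/
def localRep (u : ℝ³ → ℝ³) (c : ℝ³) (r : ℝ) (m : Fin 3) (x : ℝ³) : ℝ :=
  -(fderiv ℝ (newtonNearPotential (r / 2) r (locVort u c r (succIdx₂ m))) x (𝐞 (succIdx m)) -
      fderiv ℝ (newtonNearPotential (r / 2) r (locVort u c r (succIdx m))) x (𝐞 (succIdx₂ m))) +
    newtonFarSmoothing (r / 2) r (locVel u c r m) x

/-- **The local Biot–Savart law on `B(c, r)`**: `uₘ = Rₘ` there (Tao: "On `2Bᵢ`, we thus have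
the local Biot-Savart law `u = O(Δ⁻¹∇(ψᵢω)) + v`"; here `v` is the explicit smoothing
`Λ[ψuₘ]`). [cite: Tao2011, §10, proof of Thm. 10.1 (p. 32)] -/
theorem eqOn_coord_localRep (hu : ContDiff ℝ ∞ u) (hdiv : VectorCalculus.IsDivFree u) (hr : 0 < r)
    (m : Fin 3) : EqOn (fun x => u x m) (localRep u c r m) (ball c r) := by
  intro x hx
  have h1 : u x m = locVel u c r m x := by
    have hx2 : x ∈ ball c (2 * r) := ball_subset_ball (by linarith) hx
    rw [locVel, ballCutoff_eq_one hr]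
    · rw [one_mul]
    · rw [mem_ball, dist_eq_norm] at hx2; exact hx2.le
  show u x m = localRep u c r m x
  rw [h1, locVel_eq_rep hu hr m x, newtonNearPotential_laplacian_locVel_eq hu hdiv hr m hx, localRep]

/-- The Hessian entries of the potentials of the localised vorticity:
`H k a b (x) = ∂ₖ∂ₐN[W_b](x)`. [folklore] -/
def hessPot (u : ℝ³ → ℝ³) (c : ℝ³) (r : ℝ) (k a b : Fin 3) (x : ℝ³) : ℝ :=
  fderiv ℝ (fun y => fderiv ℝ (newtonNearPotential (r / 2) r (locVort u c r b)) y (𝐞 a)) x (𝐞 k)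

/-- **The derivative of the local representation**: for `x ∈ B(c, r)`,
`∂ₖuₘ(x) = -(H k (m+1) (m+2) (x) - H k (m+2) (m+1) (x)) + ∂ₖΛ[Φₘ](x)`. [folklore] -/
theorem fderiv_coord_eq (hu : ContDiff ℝ ∞ u) (hdiv : VectorCalculus.IsDivFree u) (hr : 0 < r)
    (m k : Fin 3) {x : ℝ³} (hx : x ∈ ball c r) :
    fderiv ℝ u x (𝐞 k) m =
      -(hessPot u c r k (succIdx m) (succIdx₂ m) x - hessPot u c r k (succIdx₂ m) (succIdx m) x) +
        fderiv ℝ (newtonFarSmoothing (r / 2) r (locVel u c r m)) x (𝐞 k) := by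
  have h₀ : (0 : ℝ) < r / 2 := half_pos hr
  have h₁ : r / 2 < r := half_lt_self hr
  have hu1 : ContDiff ℝ 1 u := hu.of_le (by norm_cast)
  -- `∂ₖuₘ = ∂ₖRₘ` at `x`
  have hev : (fun y => u y m) =ᶠ[𝓝 x] localRep u c r m :=
    eventually_of_mem (isOpen_ball.mem_nhds hx) (eqOn_coord_localRep hu hdiv hr m)
  rw [← fderiv_apply_coord (hu1.differentiable one_ne_zero x), hev.fderiv_eq]
  -- differentiability of the three pieces of `Rₘ`
  have hN : ∀ b, ContDiff ℝ 2 (newtonNearPotential (r / 2) r (locVort u c r b)) := fun b =>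
    contDiff_newtonNearPotential h₀.le h₁ 2 (contDiff_locVort hu c r b)
  have hD : ∀ a b, Differentiable ℝ fun y => fderiv ℝ (newtonNearPotential (r / 2) r (locVort u c r b)) y (𝐞 a) :=
    fun a b => (((hN b).fderiv_right (m := 1) le_rfl).clm_apply contDiff_const).differentiable one_ne_zero
  have hΛ : Differentiable ℝ (newtonFarSmoothing (r / 2) r (locVel u c r m)) :=
    (contDiff_newtonFarSmoothing h₀ h₁ 1 (contDiff_locVel hu c r m)).differentiable one_ne_zero
  have hF : HasFDerivAt (localRep u c r m)
      (-(fderiv ℝ (fun y => fderiv ℝ (newtonNearPotential (r / 2) r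
            (locVort u c r (succIdx₂ m))) y (𝐞 (succIdx m))) x -
          fderiv ℝ (fun y => fderiv ℝ (newtonNearPotential (r / 2) r
            (locVort u c r (succIdx m))) y (𝐞 (succIdx₂ m))) x) +
        fderiv ℝ (newtonFarSmoothing (r / 2) r (locVel u c r m)) x) x := by
    unfold localRep
    exact (((hD _ _ x).hasFDerivAt.sub (hD _ _ x).hasFDerivAt).neg).add (hΛ x).hasFDerivAt
  rw [hF.fderiv]
  rfl

/-- **The pointwise bound for the entries of `∇u` on `B(c, r)`**:
`|∂ₖuₘ(x)| ≤ Σₐ Σ_b |∂ₖ∂ₐN[W_b](x)| + |∂ₖΛ[Φₘ](x)|`. [cite: Tao2011, §10, proof of Thm. 10.1 (p. 32)] -/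
theorem abs_fderiv_coord_le (hu : ContDiff ℝ ∞ u) (hdiv : VectorCalculus.IsDivFree u) (hr : 0 < r)
    (m k : Fin 3) {x : ℝ³} (hx : x ∈ ball c r) :
    |fderiv ℝ u x (𝐞 k) m| ≤
      (∑ a, ∑ b, |hessPot u c r k a b x|) +
        |fderiv ℝ (newtonFarSmoothing (r / 2) r (locVel u c r m)) x (𝐞 k)| := by
  rw [fderiv_coord_eq hu hdiv hr m k hx]
  have hsub : |hessPot u c r k (succIdx m) (succIdx₂ m) x| + |hessPot u c r k (succIdx₂ m) (succIdx m) x| ≤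
      ∑ a, ∑ b, |hessPot u c r k a b x| := by
    have hnn : ∀ a b, 0 ≤ |hessPot u c r k a b x| := fun _ _ => abs_nonneg _
    have hne : succIdx m ≠ succIdx₂ m := by fin_cases m <;> decide
    calc |hessPot u c r k (succIdx m) (succIdx₂ m) x| + |hessPot u c r k (succIdx₂ m) (succIdx m) x|
        ≤ (∑ b, |hessPot u c r k (succIdx m) b x|) + ∑ b, |hessPot u c r k (succIdx₂ m) b x| :=
          add_le_add
            (Finset.single_le_sum (f := fun b => |hessPot u c r k (succIdx m) b x|) (fun b _ => hnn _ b)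
              (Finset.mem_univ _))
            (Finset.single_le_sum (f := fun b => |hessPot u c r k (succIdx₂ m) b x|) (fun b _ => hnn _ b)
              (Finset.mem_univ _))
      _ = ∑ a ∈ ({succIdx m, succIdx₂ m} : Finset (Fin 3)), ∑ b, |hessPot u c r k a b x| := by
          rw [Finset.sum_pair hne]
      _ ≤ ∑ a, ∑ b, |hessPot u c r k a b x| :=
          Finset.sum_le_sum_of_subset_of_nonneg (Finset.subset_univ _)
            (fun a _ _ => Finset.sum_nonneg fun b _ => hnn a b)
  calc |-(hessPot u c r k (succIdx m) (succIdx₂ m) x - hessPot u c r k (succIdx₂ m) (succIdx m) x) +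
          fderiv ℝ (newtonFarSmoothing (r / 2) r (locVel u c r m)) x (𝐞 k)|
      ≤ |-(hessPot u c r k (succIdx m) (succIdx₂ m) x - hessPot u c r k (succIdx₂ m) (succIdx m) x)| +
          |fderiv ℝ (newtonFarSmoothing (r / 2) r (locVel u c r m)) x (𝐞 k)| := abs_add_le _ _
    _ ≤ (|hessPot u c r k (succIdx m) (succIdx₂ m) x| + |hessPot u c r k (succIdx₂ m) (succIdx m) x|) +
          |fderiv ℝ (newtonFarSmoothing (r / 2) r (locVel u c r m)) x (𝐞 k)| := by
        gcongr
        rw [abs_neg]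
        exact abs_sub _ _
    _ ≤ _ := by gcongr

end Representation

/-! ### The pointwise majorant `F` and the main bound -/

section Bound

variable {u : ℝ³ → ℝ³} {c : ℝ³} {r : ℝ}

/-- The entries `H k a b` are continuous. [folklore] -/
theorem continuous_hessPot (hu : ContDiff ℝ ∞ u) (hr : 0 < r) (k a b : Fin 3) :
    Continuous (hessPot u c r k a b) := by
  have hN : ContDiff ℝ 2 (newtonNearPotential (r / 2) r (locVort u c r b)) :=
    contDiff_newtonNearPotential (half_pos hr).le (half_lt_self hr) 2 (contDiff_locVort hu c r b)
  have h1 : ContDiff ℝ 1 fun y => fderiv ℝ (newtonNearPotential (r / 2) r (locVort u c r b)) y (𝐞 a) :=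
    (hN.fderiv_right (m := 1) le_rfl).clm_apply contDiff_const
  exact (h1.continuous_fderiv one_ne_zero).clm_apply continuous_const

/-- The entries `H k a b` have compact support. [folklore] -/
theorem hasCompactSupport_hessPot (hr : 0 < r) (u : ℝ³ → ℝ³) (k a b : Fin 3) :
    HasCompactSupport (hessPot u c r k a b) :=
  ((hasCompactSupport_newtonNearPotential (half_pos hr).le (half_lt_self hr)
    (hasCompactSupport_locVort hr u b)).fderiv_apply ℝ (𝐞 a)).fderiv_apply ℝ (𝐞 k)

/-- **`L²` bound for the Hessian entries** (Tao's Plancherel step):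
`Σₖ Σₐ ∫ (H k a b)² ≤ 2(1 + M²) ∫ W_b²`. [cite: Tao2011, §10, proof of Thm. 10.1 (Plancherel step for Y₆,₁)] -/
theorem sum_integral_sq_hessPot_le (hu : ContDiff ℝ ∞ u) (hr : 0 < r) (b : Fin 3) :
    ∑ k, ∑ a, ∫ x, hessPot u c r k a b x ^ 2 ≤
      2 * (1 + regLaplacianMass ^ 2) * ∫ y, locVort u c r b y ^ 2 := by
  have h := sum_integral_sq_fderiv_fderiv_newtonNearPotential_le (EuclideanSpace.basisFun (Fin 3) ℝ)
    (half_pos hr) (half_lt_self hr) (contDiff_locVort hu c r b (n := 3)) (hasCompactSupport_locVort hr u b)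
  rw [integral_abs_newtonFarLaplacian_half hr] at h
  simp only [EuclideanSpace.basisFun_apply] at h
  rw [Finset.sum_comm]
  exact h

/-- `Σ_b ∫ W_b² ≤ ∫_{B(c,3r)} |ω|²`. [folklore] -/
theorem sum_integral_sq_locVort_le (hu : ContDiff ℝ ∞ u) (hr : 0 < r) :
    ∑ b, ∫ y, locVort u c r b y ^ 2 ≤ ∫ y in ball c (3 * r), ‖curl u y‖ ^ 2 := by
  have hω : Continuous (curl u) := continuous_curl (hu.of_le (by norm_cast))
  have hωb : ∀ b, Continuous fun y => curl u y b := fun b =>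
    (EuclideanSpace.proj b : ℝ³ →L[ℝ] ℝ).continuous.comp hω
  calc ∑ b, ∫ y, locVort u c r b y ^ 2 ≤ ∑ b, ∫ y in ball c (3 * r), (curl u y b) ^ 2 :=
        Finset.sum_le_sum fun b _ => integral_sq_ballCutoff_mul_le hr (hωb b)
    _ = ∫ y in ball c (3 * r), ∑ b, (curl u y b) ^ 2 := by
        rw [integral_finsetSum]
        intro b _
        exact (((hωb b).pow 2).continuousOn.integrableOn_compact (isCompact_closedBall c (3 * r))).mono_set
          ball_subset_closedBall
    _ = ∫ y in ball c (3 * r), ‖curl u y‖ ^ 2 := by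
        refine setIntegral_congr_fun measurableSet_ball fun y _ => ?_
        rw [EuclideanSpace.norm_eq, Real.sq_sqrt (Finset.sum_nonneg fun _ _ => sq_nonneg _)]
        simp only [Real.norm_eq_abs, sq_abs]

/-- The singular majorant `F₀ = Σₖ Σₐ Σ_b |H k a b|`. [folklore] -/
def hessMajorant (u : ℝ³ → ℝ³) (c : ℝ³) (r : ℝ) (x : ℝ³) : ℝ :=
  ∑ k, ∑ a, ∑ b, |hessPot u c r k a b x|

/-- `F₀` is continuous. [folklore] -/
theorem continuous_hessMajorant (hu : ContDiff ℝ ∞ u) (hr : 0 < r) :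
    Continuous (hessMajorant u c r) :=
  continuous_finsetSum _ fun k _ => continuous_finsetSum _ fun a _ =>
    continuous_finsetSum _ fun b _ => (continuous_hessPot hu hr k a b).abs

/-- `0 ≤ F₀`. [folklore] -/
theorem hessMajorant_nonneg (u : ℝ³ → ℝ³) (c : ℝ³) (r : ℝ) (x : ℝ³) : 0 ≤ hessMajorant u c r x :=
  Finset.sum_nonneg fun _ _ => Finset.sum_nonneg fun _ _ => Finset.sum_nonneg fun _ _ => abs_nonneg _

/-- `F₀² ≤ 27 Σₖ Σₐ Σ_b (H k a b)²` (Cauchy–Schwarz on the `27` terms). [folklore] -/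
theorem sq_hessMajorant_le (u : ℝ³ → ℝ³) (c : ℝ³) (r : ℝ) (x : ℝ³) :
    hessMajorant u c r x ^ 2 ≤ 27 * ∑ k, ∑ a, ∑ b, hessPot u c r k a b x ^ 2 := by
  have h3 : ∀ (f : Fin 3 → ℝ), (∑ i, f i) ^ 2 ≤ 3 * ∑ i, f i ^ 2 := fun f => by
    have := sq_sum_le_card_mul_sum_sq (s := (Finset.univ : Finset (Fin 3))) (f := f)
    simpa using this
  rw [hessMajorant]
  calc (∑ k, ∑ a, ∑ b, |hessPot u c r k a b x|) ^ 2
      ≤ 3 * ∑ k, (∑ a, ∑ b, |hessPot u c r k a b x|) ^ 2 := h3 _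
    _ ≤ 3 * ∑ k, (3 * ∑ a, (∑ b, |hessPot u c r k a b x|) ^ 2) := by
        gcongr with k _
        exact h3 _
    _ ≤ 3 * ∑ k, (3 * ∑ a, (3 * ∑ b, |hessPot u c r k a b x| ^ 2)) := by
        gcongr with k _ a _
        exact h3 _
    _ = 27 * ∑ k, ∑ a, ∑ b, hessPot u c r k a b x ^ 2 := by
        simp only [sq_abs, Finset.mul_sum]
        ring_nf

/-- `(H k a b)²` is integrable. [folklore] -/
theorem integrable_sq_hessPot (hu : ContDiff ℝ ∞ u) (hr : 0 < r) (k a b : Fin 3) :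
    Integrable fun x => hessPot u c r k a b x ^ 2 :=
  integrable_sq_of_hasCompactSupport (continuous_hessPot hu hr k a b) (hasCompactSupport_hessPot hr u k a b)

/-- `F₀²` is integrable. [folklore] -/
theorem integrable_sq_hessMajorant (hu : ContDiff ℝ ∞ u) (hr : 0 < r) :
    Integrable fun x => hessMajorant u c r x ^ 2 := by
  have hint : Integrable fun x => 27 * ∑ k, ∑ a, ∑ b, hessPot u c r k a b x ^ 2 :=
    (integrable_finsetSum _ fun k _ => integrable_finsetSum _ fun a _ =>
      integrable_finsetSum _ fun b _ => integrable_sq_hessPot hu hr k a b).const_mul 27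
  refine hint.mono' (((continuous_hessMajorant hu hr).pow 2).aestronglyMeasurable)
    (Eventually.of_forall fun x => ?_)
  rw [Real.norm_eq_abs, abs_of_nonneg (sq_nonneg _)]
  exact sq_hessMajorant_le u c r x

/-- **`∫ F₀² ≤ 54(1 + M²) ∫_{B(c,3r)} |ω|²`.** [cite: Tao2011, §10, proof of Thm. 10.1 (Plancherel step for Y₆,₁)] -/
theorem integral_sq_hessMajorant_le (hu : ContDiff ℝ ∞ u) (hr : 0 < r) :
    ∫ x, hessMajorant u c r x ^ 2 ≤
      54 * (1 + regLaplacianMass ^ 2) * ∫ y in ball c (3 * r), ‖curl u y‖ ^ 2 := by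
  have hM : 0 ≤ 1 + regLaplacianMass ^ 2 := by positivity
  calc ∫ x, hessMajorant u c r x ^ 2 ≤ ∫ x, 27 * ∑ k, ∑ a, ∑ b, hessPot u c r k a b x ^ 2 :=
        integral_mono (integrable_sq_hessMajorant hu hr)
          ((integrable_finsetSum _ fun k _ => integrable_finsetSum _ fun a _ =>
            integrable_finsetSum _ fun b _ => integrable_sq_hessPot hu hr k a b).const_mul 27)
          (sq_hessMajorant_le u c r)
    _ = 27 * ∑ b, ∑ k, ∑ a, ∫ x, hessPot u c r k a b x ^ 2 := by
        rw [integral_const_mul, integral_finsetSum _ fun k _ => integrable_finsetSum _ fun a _ =>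
          integrable_finsetSum _ fun b _ => integrable_sq_hessPot hu hr k a b]
        congr 1
        rw [Finset.sum_comm]
        refine Finset.sum_congr rfl fun k _ => ?_
        rw [integral_finsetSum _ fun a _ => integrable_finsetSum _ fun b _ => integrable_sq_hessPot hu hr k a b,
          Finset.sum_comm]
        refine Finset.sum_congr rfl fun a _ => ?_
        rw [integral_finsetSum _ fun b _ => integrable_sq_hessPot hu hr k a b]
    _ ≤ 27 * ∑ b : Fin 3, 2 * (1 + regLaplacianMass ^ 2) * ∫ y, locVort u c r b y ^ 2 := by
        gcongr with b _
        exact sum_integral_sq_hessPot_le hu hr b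
    _ = 54 * (1 + regLaplacianMass ^ 2) * ∑ b, ∫ y, locVort u c r b y ^ 2 := by
        rw [← Finset.mul_sum]; ring
    _ ≤ 54 * (1 + regLaplacianMass ^ 2) * ∫ y in ball c (3 * r), ‖curl u y‖ ^ 2 := by
        gcongr
        exact sum_integral_sq_locVort_le hu hr


/-! ### The smoothing majorant and the main theorem -/

/-- **The operator norm of `Du` on `B(c, r)`** is controlled by the singular majorant and the
smoothing terms: `‖Du(x)‖ ≤ 3F₀(x) + Σₖ Σₘ |∂ₖΛ[Φₘ](x)|`. [cite: Tao2011, §10, proof of Thm. 10.1 (p. 32)] -/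
theorem opNorm_fderiv_le_hessMajorant_add (hu : ContDiff ℝ ∞ u) (hdiv : VectorCalculus.IsDivFree u)
    (hr : 0 < r) {x : ℝ³} (hx : x ∈ ball c r) :
    ‖fderiv ℝ u x‖ ≤ 3 * hessMajorant u c r x +
      ∑ k, ∑ m, |fderiv ℝ (newtonFarSmoothing (r / 2) r (locVel u c r m)) x (𝐞 k)| := by
  calc ‖fderiv ℝ u x‖ ≤ ∑ k, ∑ m, |fderiv ℝ u x (𝐞 k) m| := opNorm_le_sum_abs_coord _
    _ ≤ ∑ k, ∑ m, ((∑ a, ∑ b, |hessPot u c r k a b x|) +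
          |fderiv ℝ (newtonFarSmoothing (r / 2) r (locVel u c r m)) x (𝐞 k)|) := by
        gcongr with k _ m _
        exact abs_fderiv_coord_le hu hdiv hr m k hx
    _ = 3 * hessMajorant u c r x +
          ∑ k, ∑ m, |fderiv ℝ (newtonFarSmoothing (r / 2) r (locVel u c r m)) x (𝐞 k)| := by
        rw [hessMajorant, Finset.mul_sum, ← Finset.sum_add_distrib]
        refine Finset.sum_congr rfl fun k _ => ?_
        rw [Finset.sum_add_distrib, Finset.sum_const, Finset.card_univ, Fintype.card_fin,
          nsmul_eq_mul, Nat.cast_ofNat]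

/-- `|Φₘ| ≤ ‖u‖` pointwise. [folklore] -/
theorem abs_locVel_le (u : ℝ³ → ℝ³) (c : ℝ³) (r : ℝ) (m : Fin 3) (y : ℝ³) :
    |locVel u c r m y| ≤ ‖u y‖ := by
  rw [locVel, abs_mul]
  calc |ballCutoff c r y| * |u y m| ≤ 1 * |u y m| :=
        mul_le_mul_of_nonneg_right (abs_ballCutoff_le_one c r y) (abs_nonneg _)
    _ = ‖u y m‖ := by rw [one_mul, Real.norm_eq_abs]
    _ ≤ ‖u y‖ := PiLp.norm_apply_le (u y) m

/-- **The smoothing terms, energy form**: `Σₖ Σₘ |∂ₖΛ[Φₘ](x)| ≤ 3 C₂ r^{-5/2} ‖u‖_{L²}`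
(Tao's `rᵢ^{-5/2}‖u‖_{L²(2Bᵢ)}`, with the global energy). [cite: Tao2011, §10, proof of Thm. 10.1 (p. 32)] -/
theorem sum_abs_fderiv_smoothing_le_sqrt (hu : ContDiff ℝ ∞ u) (hr : 0 < r)
    (hL2 : Integrable fun y => ‖u y‖ ^ 2) (x : ℝ³) :
    ∑ k, ∑ m, |fderiv ℝ (newtonFarSmoothing (r / 2) r (locVel u c r m)) x (𝐞 k)| ≤
      3 * (Real.sqrt (r⁻¹ ^ 5) * lamGradL2) * Real.sqrt (∫ y, ‖u y‖ ^ 2) := by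
  have h₀ := half_pos hr
  have h₁ := half_lt_self hr
  have hΦc : ∀ m, Continuous (locVel u c r m) := fun m => (contDiff_locVel hu c r m (n := 0)).continuous
  have hΦs : ∀ m, HasCompactSupport (locVel u c r m) := fun m => hasCompactSupport_locVel hr u m
  have hΦ2 : ∀ m, ∫ y, locVel u c r m y ^ 2 ≤ ∫ y, ‖u y‖ ^ 2 := fun m =>
    integral_mono (integrable_sq_of_hasCompactSupport (hΦc m) (hΦs m)) hL2 fun y => by
      calc locVel u c r m y ^ 2 = |locVel u c r m y| ^ 2 := (sq_abs _).symm
        _ ≤ ‖u y‖ ^ 2 := pow_le_pow_left₀ (abs_nonneg _) (abs_locVel_le u c r m y) 2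
  set A := Real.sqrt (∫ y, ‖u y‖ ^ 2) with hA
  set B : Fin 3 → ℝ := fun k => Real.sqrt (∫ z, (fderiv ℝ (newtonFarLaplacian (r / 2) r) z (𝐞 k)) ^ 2)
    with hB
  calc ∑ k, ∑ m, |fderiv ℝ (newtonFarSmoothing (r / 2) r (locVel u c r m)) x (𝐞 k)|
      ≤ ∑ k, ∑ _m : Fin 3, A * B k := by
        gcongr with k _ m _
        calc |fderiv ℝ (newtonFarSmoothing (r / 2) r (locVel u c r m)) x (𝐞 k)|
            ≤ Real.sqrt (∫ y, locVel u c r m y ^ 2) * B k :=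
              abs_fderiv_newtonFarSmoothing_le_sqrt h₀ h₁ (hΦc m) (hΦs m) x (𝐞 k)
          _ ≤ A * B k := mul_le_mul_of_nonneg_right (Real.sqrt_le_sqrt (hΦ2 m)) (Real.sqrt_nonneg _)
    _ = 3 * A * ∑ k, B k := by
        simp only [Finset.sum_const, Finset.card_univ, Fintype.card_fin, nsmul_eq_mul, Nat.cast_ofNat]
        rw [Finset.mul_sum]
        refine Finset.sum_congr rfl fun k _ => by ring
    _ = 3 * (Real.sqrt (r⁻¹ ^ 5) * lamGradL2) * A := by
        rw [hB, sum_sqrt_integral_sq_fderiv_newtonFarLaplacian_half hr]; ring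

/-- **The smoothing terms, speed form**: if `‖u‖ ≤ s` everywhere then
`Σₖ Σₘ |∂ₖΛ[Φₘ](x)| ≤ 3 C₁ r⁻¹ s` (Tao: "we use Hölder to bound
`r^{-3/2}‖u‖_{L²(2Bᵢ)} ≲ ‖u‖_{L^∞}`"). [cite: Tao2011, §10, proof of Thm. 10.1 (p. 32)] -/
theorem sum_abs_fderiv_smoothing_le_of_bound (hu : ContDiff ℝ ∞ u) (hr : 0 < r) {s : ℝ}
    (hs : ∀ y, ‖u y‖ ≤ s) (x : ℝ³) :
    ∑ k, ∑ m, |fderiv ℝ (newtonFarSmoothing (r / 2) r (locVel u c r m)) x (𝐞 k)| ≤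
      3 * (r⁻¹ * lamGradL1) * s := by
  have h₀ := half_pos hr
  have h₁ := half_lt_self hr
  have hΦc : ∀ m, Continuous (locVel u c r m) := fun m => (contDiff_locVel hu c r m (n := 0)).continuous
  have hΦs : ∀ m, HasCompactSupport (locVel u c r m) := fun m => hasCompactSupport_locVel hr u m
  have hΦb : ∀ m y, |locVel u c r m y| ≤ s := fun m y => (abs_locVel_le u c r m y).trans (hs y)
  set B : Fin 3 → ℝ := fun k => ∫ z, |fderiv ℝ (newtonFarLaplacian (r / 2) r) z (𝐞 k)| with hB
  calc ∑ k, ∑ m, |fderiv ℝ (newtonFarSmoothing (r / 2) r (locVel u c r m)) x (𝐞 k)|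
      ≤ ∑ k, ∑ _m : Fin 3, s * B k := by
        gcongr with k _ m _
        exact abs_fderiv_newtonFarSmoothing_le_of_abs_le h₀ h₁ (hΦc m) (hΦs m) (hΦb m) x (𝐞 k)
    _ = 3 * s * ∑ k, B k := by
        simp only [Finset.sum_const, Finset.card_univ, Fintype.card_fin, nsmul_eq_mul, Nat.cast_ofNat]
        rw [Finset.mul_sum]
        refine Finset.sum_congr rfl fun k _ => by ring
    _ = 3 * (r⁻¹ * lamGradL1) * s := by
        rw [hB, sum_integral_abs_fderiv_newtonFarLaplacian_half hr]; ring

/-- **The local Biot–Savart bound** (Tao 2011, proof of Thm. 10.1, the pointwise estimate for `∇u`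
on a Whitney ball, p. 32). For `u ∈ C^∞(ℝ³; ℝ³)` divergence free, a centre `c` and a radius
`r > 0` there is a continuous majorant `F ≥ 0` — `F = 3Σ|∂ₖ∂ₐN[ψω_b]|`, a localised singular
integral of the vorticity `ω = curl u` — with

* `∫ F² ≤ 486 (1 + M²) ∫_{B(c,3r)} |ω|²` (`M = regLaplacianMass`; Tao: `‖Fᵢ‖_{L²(Bᵢ)} ≲ ‖ω‖_{L²(2Bᵢ)}`),
* `‖Du(x)‖ ≤ F(x) + 3C₂ r^{-5/2} ‖u‖_{L²(ℝ³)}` for `x ∈ B(c, r)` if `u ∈ L²`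
  (Tao: `+ rᵢ^{-5/2}‖u‖_{L²(2Bᵢ)}`),
* `‖Du(x)‖ ≤ F(x) + 3C₁ r⁻¹ s` for `x ∈ B(c, r)` if `|u| ≤ s` (Tao: `≲ ‖u‖_{L^∞}` on the layer),

`C₁ = lamGradL1`, `C₂ = lamGradL2` absolute constants. The harmonic remainder of the printed
proof is replaced by the smoothing operator of Green's representation at scale `r`. [cite: Tao2011, §10, proof of Thm. 10.1 (p. 32)] -/
theorem local_biotSavart_bound (hu : ContDiff ℝ ∞ u) (hdiv : VectorCalculus.IsDivFree u) (c : ℝ³)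
    (hr : 0 < r) :
    ∃ F : ℝ³ → ℝ, Continuous F ∧ (∀ x, 0 ≤ F x) ∧ Integrable (fun x => F x ^ 2) ∧
      (∫ x, F x ^ 2 ≤ 486 * (1 + regLaplacianMass ^ 2) * ∫ y in ball c (3 * r), ‖curl u y‖ ^ 2) ∧
      (Integrable (fun y => ‖u y‖ ^ 2) → ∀ x ∈ ball c r,
        ‖fderiv ℝ u x‖ ≤ F x + 3 * lamGradL2 * Real.sqrt (r⁻¹ ^ 5) * Real.sqrt (∫ y, ‖u y‖ ^ 2)) ∧
      (∀ s : ℝ, (∀ y, ‖u y‖ ≤ s) → ∀ x ∈ ball c r,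
        ‖fderiv ℝ u x‖ ≤ F x + 3 * lamGradL1 * r⁻¹ * s) := by
  refine ⟨fun x => 3 * hessMajorant u c r x, continuous_const.mul (continuous_hessMajorant hu hr),
    fun x => mul_nonneg (by norm_num) (hessMajorant_nonneg u c r x), ?_, ?_, ?_, ?_⟩
  · have h := (integrable_sq_hessMajorant (c := c) hu hr).const_mul 9
    exact h.congr (Eventually.of_forall fun x => by ring)
  · calc ∫ x, (3 * hessMajorant u c r x) ^ 2 = ∫ x, 9 * hessMajorant u c r x ^ 2 :=
          integral_congr_ae (Eventually.of_forall fun x => by ring)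
      _ = 9 * ∫ x, hessMajorant u c r x ^ 2 := integral_const_mul _ _
      _ ≤ 9 * (54 * (1 + regLaplacianMass ^ 2) * ∫ y in ball c (3 * r), ‖curl u y‖ ^ 2) := by
          gcongr
          exact integral_sq_hessMajorant_le hu hr
      _ = 486 * (1 + regLaplacianMass ^ 2) * ∫ y in ball c (3 * r), ‖curl u y‖ ^ 2 := by ring
  · intro hL2 x hx
    calc ‖fderiv ℝ u x‖ ≤ 3 * hessMajorant u c r x +
          ∑ k, ∑ m, |fderiv ℝ (newtonFarSmoothing (r / 2) r (locVel u c r m)) x (𝐞 k)| :=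
          opNorm_fderiv_le_hessMajorant_add hu hdiv hr hx
      _ ≤ 3 * hessMajorant u c r x + 3 * (Real.sqrt (r⁻¹ ^ 5) * lamGradL2) * Real.sqrt (∫ y, ‖u y‖ ^ 2) := by
          gcongr
          exact sum_abs_fderiv_smoothing_le_sqrt hu hr hL2 x
      _ = _ := by ring
  · intro s hs x hx
    calc ‖fderiv ℝ u x‖ ≤ 3 * hessMajorant u c r x +
          ∑ k, ∑ m, |fderiv ℝ (newtonFarSmoothing (r / 2) r (locVel u c r m)) x (𝐞 k)| :=
          opNorm_fderiv_le_hessMajorant_add hu hdiv hr hx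
      _ ≤ 3 * hessMajorant u c r x + 3 * (r⁻¹ * lamGradL1) * s := by
          gcongr
          exact sum_abs_fderiv_smoothing_le_of_bound hu hr hs x
      _ = _ := by ring

/-! ### The local energy form of the smoothing bound (no global integrability needed) -/

/-- `∫ Φₘ² ≤ ∫_{B(c,3r)} ‖u‖²` (the localised velocity component is supported in `B(c, 3r)`). [folklore] -/
theorem integral_sq_locVel_le_local (hu : ContDiff ℝ ∞ u) (hr : 0 < r) (m : Fin 3) :
    ∫ y, locVel u c r m y ^ 2 ≤ ∫ y in ball c (3 * r), ‖u y‖ ^ 2 := by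
  have hcont : Continuous fun y => u y m := contDiff_apply_coord (n := 0) (hu.of_le (by norm_cast)) m |>.continuous
  have h1 : ∫ y, locVel u c r m y ^ 2 ≤ ∫ y in ball c (3 * r), (u y m) ^ 2 :=
    integral_sq_ballCutoff_mul_le hr hcont
  refine h1.trans (setIntegral_mono_on ?_ ?_ measurableSet_ball fun y _ => ?_)
  · exact ((hcont.pow 2).continuousOn.integrableOn_compact (isCompact_closedBall c (3 * r))).mono_set
      ball_subset_closedBall
  · exact (((hu.continuous.norm).pow 2).continuousOn.integrableOn_compact
      (isCompact_closedBall c (3 * r))).mono_set ball_subset_closedBall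
  · calc u y m ^ 2 = |u y m| ^ 2 := (sq_abs _).symm
      _ ≤ ‖u y‖ ^ 2 := pow_le_pow_left₀ (abs_nonneg _)
          (by rw [← Real.norm_eq_abs]; exact PiLp.norm_apply_le (u y) m) 2

/-- **The smoothing terms, local energy form** (Tao's printed `rᵢ^{-5/2}‖u‖_{L²(2Bᵢ)}`, here with
the honest support radius `3r` and no global hypothesis on `u`):
`Σₖ Σₘ |∂ₖΛ[Φₘ](x)| ≤ 3 C₂ r^{-5/2} ‖u‖_{L²(B(c,3r))}`. [cite: Tao2011, §10, proof of Thm. 10.1 (p. 32)] -/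
theorem sum_abs_fderiv_smoothing_le_sqrt_local (hu : ContDiff ℝ ∞ u) (hr : 0 < r) (x : ℝ³) :
    ∑ k, ∑ m, |fderiv ℝ (newtonFarSmoothing (r / 2) r (locVel u c r m)) x (𝐞 k)| ≤
      3 * (Real.sqrt (r⁻¹ ^ 5) * lamGradL2) * Real.sqrt (∫ y in ball c (3 * r), ‖u y‖ ^ 2) := by
  have h₀ := half_pos hr
  have h₁ := half_lt_self hr
  have hΦc : ∀ m, Continuous (locVel u c r m) := fun m => (contDiff_locVel hu c r m (n := 0)).continuous
  have hΦs : ∀ m, HasCompactSupport (locVel u c r m) := fun m => hasCompactSupport_locVel hr u m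
  set A := Real.sqrt (∫ y in ball c (3 * r), ‖u y‖ ^ 2) with hA
  set B : Fin 3 → ℝ := fun k => Real.sqrt (∫ z, (fderiv ℝ (newtonFarLaplacian (r / 2) r) z (𝐞 k)) ^ 2)
    with hB
  calc ∑ k, ∑ m, |fderiv ℝ (newtonFarSmoothing (r / 2) r (locVel u c r m)) x (𝐞 k)|
      ≤ ∑ k, ∑ _m : Fin 3, A * B k := by
        gcongr with k _ m _
        calc |fderiv ℝ (newtonFarSmoothing (r / 2) r (locVel u c r m)) x (𝐞 k)|
            ≤ Real.sqrt (∫ y, locVel u c r m y ^ 2) * B k :=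
              abs_fderiv_newtonFarSmoothing_le_sqrt h₀ h₁ (hΦc m) (hΦs m) x (𝐞 k)
          _ ≤ A * B k := mul_le_mul_of_nonneg_right
              (Real.sqrt_le_sqrt (integral_sq_locVel_le_local hu hr m)) (Real.sqrt_nonneg _)
    _ = 3 * A * ∑ k, B k := by
        simp only [Finset.sum_const, Finset.card_univ, Fintype.card_fin, nsmul_eq_mul, Nat.cast_ofNat]
        rw [Finset.mul_sum]
        refine Finset.sum_congr rfl fun k _ => by ring
    _ = 3 * (Real.sqrt (r⁻¹ ^ 5) * lamGradL2) * A := by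
        rw [hB, sum_sqrt_integral_sq_fderiv_newtonFarLaplacian_half hr]; ring

/-- **The local Biot–Savart bound, local energy form**: for `x ∈ B(c, r)`,
`‖Du(x)‖ ≤ 3F₀(x) + 3C₂ r^{-5/2} ‖u‖_{L²(B(c,3r))}` with `F₀ = hessMajorant u c r`
(`∫ (3F₀)² ≤ 486(1+M²)∫_{B(c,3r)}|ω|²` by `integral_sq_hessMajorant_le`), with no integrability
hypothesis on `u` — the printed form `|∇u| ≲ Fᵢ + rᵢ^{-5/2}‖u‖_{L²(2Bᵢ)}` (up to the support radius).
[cite: Tao2011, §10, proof of Thm. 10.1 (p. 32)] -/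
theorem opNorm_fderiv_le_local (hu : ContDiff ℝ ∞ u) (hdiv : VectorCalculus.IsDivFree u)
    (hr : 0 < r) {x : ℝ³} (hx : x ∈ ball c r) :
    ‖fderiv ℝ u x‖ ≤ 3 * hessMajorant u c r x +
      3 * lamGradL2 * Real.sqrt (r⁻¹ ^ 5) * Real.sqrt (∫ y in ball c (3 * r), ‖u y‖ ^ 2) := by
  calc ‖fderiv ℝ u x‖ ≤ 3 * hessMajorant u c r x +
        ∑ k, ∑ m, |fderiv ℝ (newtonFarSmoothing (r / 2) r (locVel u c r m)) x (𝐞 k)| :=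
        opNorm_fderiv_le_hessMajorant_add hu hdiv hr hx
    _ ≤ 3 * hessMajorant u c r x +
        3 * (Real.sqrt (r⁻¹ ^ 5) * lamGradL2) * Real.sqrt (∫ y in ball c (3 * r), ‖u y‖ ^ 2) := by
        gcongr
        exact sum_abs_fderiv_smoothing_le_sqrt_local hu hr x
    _ = _ := by ring

/-- **The local Biot–Savart bound, packaged with the local energy** (all three remainder forms).
[cite: Tao2011, §10, proof of Thm. 10.1 (p. 32)] -/
theorem local_biotSavart_bound_local (hu : ContDiff ℝ ∞ u) (hdiv : VectorCalculus.IsDivFree u)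
    (c : ℝ³) (hr : 0 < r) :
    ∃ F : ℝ³ → ℝ, Continuous F ∧ (∀ x, 0 ≤ F x) ∧ Integrable (fun x => F x ^ 2) ∧
      (∫ x, F x ^ 2 ≤ 486 * (1 + regLaplacianMass ^ 2) * ∫ y in ball c (3 * r), ‖curl u y‖ ^ 2) ∧
      (∀ x ∈ ball c r, ‖fderiv ℝ u x‖ ≤
        F x + 3 * lamGradL2 * Real.sqrt (r⁻¹ ^ 5) * Real.sqrt (∫ y in ball c (3 * r), ‖u y‖ ^ 2)) ∧
      (∀ s : ℝ, (∀ y, ‖u y‖ ≤ s) → ∀ x ∈ ball c r,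
        ‖fderiv ℝ u x‖ ≤ F x + 3 * lamGradL1 * r⁻¹ * s) := by
  refine ⟨fun x => 3 * hessMajorant u c r x, continuous_const.mul (continuous_hessMajorant hu hr),
    fun x => mul_nonneg (by norm_num) (hessMajorant_nonneg u c r x), ?_, ?_, ?_, ?_⟩
  · have h := (integrable_sq_hessMajorant (c := c) hu hr).const_mul 9
    exact h.congr (Eventually.of_forall fun x => by ring)
  · calc ∫ x, (3 * hessMajorant u c r x) ^ 2 = ∫ x, 9 * hessMajorant u c r x ^ 2 :=
          integral_congr_ae (Eventually.of_forall fun x => by ring)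
      _ = 9 * ∫ x, hessMajorant u c r x ^ 2 := integral_const_mul _ _
      _ ≤ 9 * (54 * (1 + regLaplacianMass ^ 2) * ∫ y in ball c (3 * r), ‖curl u y‖ ^ 2) := by
          gcongr
          exact integral_sq_hessMajorant_le hu hr
      _ = 486 * (1 + regLaplacianMass ^ 2) * ∫ y in ball c (3 * r), ‖curl u y‖ ^ 2 := by ring
  · intro x hx
    exact opNorm_fderiv_le_local hu hdiv hr hx
  · intro s hs x hx
    calc ‖fderiv ℝ u x‖ ≤ 3 * hessMajorant u c r x +
          ∑ k, ∑ m, |fderiv ℝ (newtonFarSmoothing (r / 2) r (locVel u c r m)) x (𝐞 k)| :=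
          opNorm_fderiv_le_hessMajorant_add hu hdiv hr hx
      _ ≤ 3 * hessMajorant u c r x + 3 * (r⁻¹ * lamGradL1) * s := by
          gcongr
          exact sum_abs_fderiv_smoothing_le_of_bound hu hr hs x
      _ = _ := by ring

end Bound

end Literature.Analysis.FluidPDE

end
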